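import Mathlib.Topology.Algebra.Order.Archimedean
import Summits.NavierStokesRegularity.NavierStokesRegularity.Theorems.LerayQuarterDissipationFiniteDissipationLiouvilleDssUniformThreshold
import Summits.NavierStokesRegularity.NavierStokesRegularity.Theorems.LerayQuarterDissipationFiniteDissipationLiouvillePortrait
import Summits.NavierStokesRegularity.NavierStokesRegularity.Theorems.PoloidalWindowDoorPoloidalWindowRigidityStrata
import HarnessLib

/-!
# Crux `FiniteDissipationLiouville` (stmt-NavierStokesRegularity-22144), line `birth`:
# the FACTOR GROUP of a Type-I ancient mild field — trivial, cyclic, or everything (and then zero)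

Theorems file of route `LerayQuarterDissipation` (lead ns-lqd-lead g7), `--supports 22144`.
Navier–Stokes regularity is NOT proved by anything here; no summit is.

For a field `W : ℝ → ℝ³ → ℝ³` call `c > 0` a PAST-DSS FACTOR of `W` when
`c • W (c² t) (c • x) = W t x` for all `t < 0` and all `x` (the clause of the line's skeleton; values
at `t ≥ 0` are not constrained by the class, cf. the disprover's `tamper`). The factors form a
subgroup of the multiplicative group `(0, ∞)` (`pastDss_mul`, `pastDss_inv`; natural powers were
`…Birth.pastDss_pow`, lead g6), and for a member of the KNSS class `IsTypeIAncientMild C W` the set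
of LOG-factors is a CLOSED additive subgroup of `ℝ` (`W` is continuous on the open past). A closed
subgroup of `ℝ` is `{0}`, `ℤσ` or `ℝ` (Mathlib's `AddSubgroup.dense_or_cyclic`), whence the

**TRICHOTOMY** (`pastDss_factor_trichotomy`): a Type-I ancient mild field in the KNSS gauge either
(i) VANISHES on the past, or (ii) has NO past-DSS factor `c ≠ 1`, or (iii) has a LEAST factor
`λ_* > 1` and its factors are exactly the integer powers `λ_*^k`, `k ∈ ℤ`. The case "all of
`(0,∞)`" is case (i): scale invariance on the past forces `W ≡ 0` there (Tsai 1998 in the KNSS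
gauge = the tree's `eq_zero_of_scaleInvariant`; no dissipation law needed).

Consequences recorded for the portrait of the crux's counterexample:
* `eq_zero_of_pastDss_incommensurable` — TWO past-DSS factors `c, d > 1` with `log c / log d`
  irrational force `W ≡ 0` on the past: a "doubly discretely self-similar" Type-I profile does not
  exist, for any pair of incommensurable factors (the dense end of the DSS wall is empty);
* `exists_least_factor_of_pastDss` — a member that is `c`-DSS on the past for some `c ≠ 1` and does
  not vanish on the past has a least factor `λ_* > 1` generating all its factors;
* `least_factor_ge_threshold_of_singular` — on the stratum `𝒟_{C,K}` the least factor of a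
  SINGULAR past-DSS member is at least the uniform threshold `λ₀(C,K) > 1` of
  `…Birth.exists_pastDss_threshold_unif` (lead g6), and every factor `c > 1` is a power `λ_*^k`,
  `k ≥ 1`.

So the DSS part of the one open stub `stub_envelopeCriticalLiouville` concerns members with a
least factor `λ_* ≥ λ₀(C,K_c)`, all other factors being its powers; nothing here removes such a
member (Bradshaw–Tsai 2017 OP 5.1 stays open). Presearch: the cyclic structure of the symmetry
group of a DSS solution is folklore (Chae–Wolf 2017 Def. 1.1 and Bradshaw–Tsai 2017 §1 fix one
`λ`); the incommensurable-pair Liouville is not stated in print but is one line from Tsai 1998 —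
recorded because the line's instrument searches factor by factor. No definitions; standard axioms.
-/

noncomputable section

-- the summit and its single sub-problem share the name (CONVENTIONS §1), as in every Theorems file
set_option linter.dupNamespace false

namespace Summit.NavierStokesRegularity.NavierStokesRegularity.Theorems.FiniteDissipationLiouville.Birth

open MeasureTheory Set Filter Topology Metric Function
open Literature.Analysis Literature.Analysis.FluidPDE
open Summit.NavierStokesRegularity.NavierStokesRegularity.Theorems.PoloidalWindowDoorPoloidalWindowRigidityStrata
  (eq_zero_of_scaleInvariant)
open scoped ENNReal NNReal

/-! ### The factor group -/

/-- Products of past-DSS factors are past-DSS factors (`c > 0`). -/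
theorem pastDss_mul {c d : ℝ} (hc : 0 < c)
    {W : ℝ → EuclideanSpace ℝ (Fin 3) → EuclideanSpace ℝ (Fin 3)}
    (hcW : ∀ t : ℝ, t < 0 → ∀ x, c • W (c ^ 2 * t) (c • x) = W t x)
    (hdW : ∀ t : ℝ, t < 0 → ∀ x, d • W (d ^ 2 * t) (d • x) = W t x) :
    ∀ t : ℝ, t < 0 → ∀ x, (c * d) • W ((c * d) ^ 2 * t) ((c * d) • x) = W t x := by
  intro t ht x
  have hct : c ^ 2 * t < 0 := mul_neg_of_pos_of_neg (by positivity) ht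
  have e1 : (c * d) ^ 2 * t = d ^ 2 * (c ^ 2 * t) := by ring
  have e2 : (c * d) • x = d • (c • x) := by rw [mul_comm, mul_smul]
  rw [e1, e2, mul_smul, hdW _ hct _, hcW t ht x]

/-- Inverses of past-DSS factors are past-DSS factors (`c > 0`). -/
theorem pastDss_inv {c : ℝ} (hc : 0 < c)
    {W : ℝ → EuclideanSpace ℝ (Fin 3) → EuclideanSpace ℝ (Fin 3)}
    (hcW : ∀ t : ℝ, t < 0 → ∀ x, c • W (c ^ 2 * t) (c • x) = W t x) :
    ∀ t : ℝ, t < 0 → ∀ x, c⁻¹ • W (c⁻¹ ^ 2 * t) (c⁻¹ • x) = W t x := by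
  intro t ht x
  have hct : c⁻¹ ^ 2 * t < 0 := mul_neg_of_pos_of_neg (by positivity) ht
  -- the identity at `(c⁻² t, c⁻¹ x)` reads `c • W t x = W (c⁻² t) (c⁻¹ x)`
  have h := hcW (c⁻¹ ^ 2 * t) hct (c⁻¹ • x)
  have e1 : c ^ 2 * (c⁻¹ ^ 2 * t) = t := by field_simp
  rw [e1, smul_inv_smul₀ hc.ne'] at h
  rw [← h, inv_smul_smul₀ hc.ne']

/-- Past-DSS factors pass to limits: if `e^{σ_n}` are past-DSS factors of a Type-I ancient mild
field and `σ_n → σ`, then `e^σ` is one (continuity of the field on the open past). Stated as: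
the set of log-factors is closed. -/
theorem isClosed_setOf_logFactor {C : ℝ}
    {W : ℝ → EuclideanSpace ℝ (Fin 3) → EuclideanSpace ℝ (Fin 3)} (hW : IsTypeIAncientMild C W) :
    IsClosed {σ : ℝ | ∀ t : ℝ, t < 0 → ∀ x,
      Real.exp σ • W (Real.exp σ ^ 2 * t) (Real.exp σ • x) = W t x} := by
  have e : {σ : ℝ | ∀ t : ℝ, t < 0 → ∀ x,
      Real.exp σ • W (Real.exp σ ^ 2 * t) (Real.exp σ • x) = W t x} =
      ⋂ (t : ℝ) (_ : t < 0) (x : EuclideanSpace ℝ (Fin 3)),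
        {σ : ℝ | Real.exp σ • W (Real.exp σ ^ 2 * t) (Real.exp σ • x) = W t x} := by
    ext σ
    simp only [mem_iInter, mem_setOf_eq]
  rw [e]
  refine isClosed_iInter fun t => isClosed_iInter fun ht => isClosed_iInter fun x => ?_
  refine isClosed_eq ?_ continuous_const
  -- `σ ↦ e^σ • W (e^{2σ} t, e^σ x)` is continuous: `W` is continuous on `(−∞,0) × ℝ³`
  have hin : Continuous fun σ : ℝ =>
      ((Real.exp σ ^ 2 * t, Real.exp σ • x) : ℝ × EuclideanSpace ℝ (Fin 3)) :=
    ((Real.continuous_exp.pow 2).mul continuous_const).prodMk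
      (Real.continuous_exp.smul continuous_const)
  have hcomp : Continuous fun σ : ℝ => uncurry W (Real.exp σ ^ 2 * t, Real.exp σ • x) :=
    hW.continuousOn_uncurry.comp_continuous hin fun σ =>
      mk_mem_prod (mul_neg_of_pos_of_neg (by positivity) ht) (mem_univ _)
  exact Real.continuous_exp.smul hcomp

/-- `e^{k σ} = (e^σ)^k` for integers `k` (via `Real.exp_mul` and `Real.rpow_intCast`). -/
theorem exp_int_mul_eq_zpow (σ : ℝ) (k : ℤ) : Real.exp ((k : ℝ) * σ) = Real.exp σ ^ k := by
  rw [mul_comm, Real.exp_mul, Real.rpow_intCast]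

/-! ### The trichotomy -/

/-- **TRICHOTOMY OF THE FACTOR GROUP.** A Type-I ancient mild field in the KNSS gauge either
vanishes on the past, or has no past-DSS factor `c ≠ 1` (`c > 0`), or has a least factor
`λ_* > 1` whose integer powers are exactly its factors. (The log-factors form a closed additive
subgroup of `ℝ`; Mathlib's `AddSubgroup.dense_or_cyclic`; a dense closed subgroup is `ℝ`, i.e.
the field is scale invariant on the past and vanishes by `eq_zero_of_scaleInvariant`.) -/
theorem pastDss_factor_trichotomy {C : ℝ}
    {W : ℝ → EuclideanSpace ℝ (Fin 3) → EuclideanSpace ℝ (Fin 3)} (hW : IsTypeIAncientMild C W) :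
    (∀ t < 0, ∀ x, W t x = 0) ∨
    (∀ c : ℝ, 0 < c → (∀ t : ℝ, t < 0 → ∀ x, c • W (c ^ 2 * t) (c • x) = W t x) → c = 1) ∨
    (∃ lam : ℝ, 1 < lam ∧ ∀ c : ℝ, 0 < c →
      ((∀ t : ℝ, t < 0 → ∀ x, c • W (c ^ 2 * t) (c • x) = W t x) ↔ ∃ k : ℤ, c = lam ^ k)) := by
  -- the additive group of log-factors
  let S : AddSubgroup ℝ :=
    { carrier := {σ : ℝ | ∀ t : ℝ, t < 0 → ∀ x,
        Real.exp σ • W (Real.exp σ ^ 2 * t) (Real.exp σ • x) = W t x}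
      zero_mem' := fun t _ x => by simp
      add_mem' := fun {a b} ha hb t ht x => by
        rw [Real.exp_add]
        exact pastDss_mul (Real.exp_pos a) ha hb t ht x
      neg_mem' := fun {a} ha t ht x => by
        rw [Real.exp_neg]
        exact pastDss_inv (Real.exp_pos a) ha t ht x }
  have hmemS : ∀ {c : ℝ}, 0 < c →
      (Real.log c ∈ S ↔ ∀ t : ℝ, t < 0 → ∀ x, c • W (c ^ 2 * t) (c • x) = W t x) := by
    intro c hc
    change (∀ t : ℝ, t < 0 → ∀ x, Real.exp (Real.log c) • W (Real.exp (Real.log c) ^ 2 * t)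
      (Real.exp (Real.log c) • x) = W t x) ↔ _
    rw [Real.exp_log hc]
  have hclosed : IsClosed (S : Set ℝ) := isClosed_setOf_logFactor hW
  rcases S.dense_or_cyclic with hd | ⟨a, ha⟩
  · -- dense and closed: every `c > 0` is a factor, so `W` is scale invariant on the past
    left
    have hall : (S : Set ℝ) = univ := by rw [← hclosed.closure_eq, hd.closure_eq]
    refine eq_zero_of_scaleInvariant hW.hasTypeITimeDecay hW.continuousOn_uncurry
      (fun s t hst ht x => hW.mild_eq_heatExtension hst ht x) (fun t ht => hW.isDivFree ht) ?_
    intro lam hlam s hs y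
    have hmem : Real.log lam ∈ (S : Set ℝ) := by rw [hall]; exact mem_univ _
    exact (hmemS hlam).1 hmem s hs y
  right
  by_cases ha0 : a = 0
  · -- trivial group: the only factor is `1`
    left
    intro c hc hcW
    have hmem : Real.log c ∈ S := (hmemS hc).2 hcW
    rw [ha, ha0, AddSubgroup.mem_closure_singleton] at hmem
    obtain ⟨n, hn⟩ := hmem
    rw [smul_zero] at hn
    rw [← Real.exp_log hc, ← hn, Real.exp_zero]
  · -- cyclic group generated by `a ≠ 0`: least factor `λ_* = e^{|a|}`
    right
    refine ⟨Real.exp |a|, ?_, ?_⟩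
    · rw [← Real.exp_zero]
      exact Real.exp_strictMono (abs_pos.2 ha0)
    have hgen : ∀ σ : ℝ, σ ∈ S ↔ ∃ k : ℤ, (k : ℝ) * |a| = σ := by
      intro σ
      rw [ha, AddSubgroup.mem_closure_singleton]
      constructor
      · rintro ⟨n, rfl⟩
        rcases le_or_gt 0 a with h0 | h0
        · exact ⟨n, by rw [abs_of_nonneg h0, zsmul_eq_mul]⟩
        · refine ⟨-n, ?_⟩
          rw [abs_of_neg h0, zsmul_eq_mul]
          push_cast
          ring
      · rintro ⟨k, rfl⟩
        rcases le_or_gt 0 a with h0 | h0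
        · exact ⟨k, by rw [abs_of_nonneg h0, zsmul_eq_mul]⟩
        · refine ⟨-k, ?_⟩
          rw [abs_of_neg h0, zsmul_eq_mul]
          push_cast
          ring
    intro c hc
    rw [← hmemS hc, hgen]
    constructor
    · rintro ⟨k, hk⟩
      refine ⟨k, ?_⟩
      rw [← exp_int_mul_eq_zpow, hk, Real.exp_log hc]
    · rintro ⟨k, rfl⟩
      exact ⟨k, by rw [← exp_int_mul_eq_zpow, Real.log_exp]⟩

/-! ### Consequences for the portrait -/

/-- **Two incommensurable past-DSS factors force triviality.** A Type-I ancient mild field that is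
`c`-DSS and `d`-DSS on the past for `c, d > 1` with `log c / log d` irrational vanishes on the
past. -/
theorem eq_zero_of_pastDss_incommensurable {C c d : ℝ}
    {W : ℝ → EuclideanSpace ℝ (Fin 3) → EuclideanSpace ℝ (Fin 3)} (hW : IsTypeIAncientMild C W)
    (hc : 1 < c) (hd : 1 < d) (hirr : Irrational (Real.log c / Real.log d))
    (hcW : ∀ t : ℝ, t < 0 → ∀ x, c • W (c ^ 2 * t) (c • x) = W t x)
    (hdW : ∀ t : ℝ, t < 0 → ∀ x, d • W (d ^ 2 * t) (d • x) = W t x) :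
    ∀ t < 0, ∀ x, W t x = 0 := by
  rcases pastDss_factor_trichotomy hW with h0 | h1 | ⟨lam, hlam, hgen⟩
  · exact h0
  · exact absurd (h1 c (one_pos.trans hc) hcW) hc.ne'
  · exfalso
    obtain ⟨k, hk⟩ := (hgen c (one_pos.trans hc)).1 hcW
    obtain ⟨m, hm⟩ := (hgen d (one_pos.trans hd)).1 hdW
    have hloglam : Real.log lam ≠ 0 :=
      Real.log_ne_zero_of_pos_of_ne_one (one_pos.trans hlam) hlam.ne'
    have hm0 : (m : ℝ) ≠ 0 := by
      intro hm0
      have : Real.log d = 0 := by rw [hm, Real.log_zpow, hm0, zero_mul]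
      exact Real.log_ne_zero_of_pos_of_ne_one (one_pos.trans hd) hd.ne' this
    apply hirr
    refine ⟨(k : ℚ) / (m : ℚ), ?_⟩
    push_cast
    rw [hk, hm, Real.log_zpow, Real.log_zpow]
    field_simp

/-- **The least factor.** A Type-I ancient mild field which does not vanish on the past and is
`c`-DSS on the past for some `c ≠ 1`, `c > 0`, has a least past-DSS factor `λ_* > 1`, and its
factors are exactly the integer powers of `λ_*`. -/
theorem exists_least_factor_of_pastDss {C c : ℝ}
    {W : ℝ → EuclideanSpace ℝ (Fin 3) → EuclideanSpace ℝ (Fin 3)} (hW : IsTypeIAncientMild C W)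
    (hne : ¬ ∀ t < 0, ∀ x, W t x = 0) (hc : 0 < c) (hc1 : c ≠ 1)
    (hcW : ∀ t : ℝ, t < 0 → ∀ x, c • W (c ^ 2 * t) (c • x) = W t x) :
    ∃ lam : ℝ, 1 < lam ∧ (∀ t : ℝ, t < 0 → ∀ x, lam • W (lam ^ 2 * t) (lam • x) = W t x) ∧
      ∀ c' : ℝ, 0 < c' →
        ((∀ t : ℝ, t < 0 → ∀ x, c' • W (c' ^ 2 * t) (c' • x) = W t x) ↔ ∃ k : ℤ, c' = lam ^ k) := by
  rcases pastDss_factor_trichotomy hW with h0 | h1 | ⟨lam, hlam, hgen⟩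
  · exact absurd h0 hne
  · exact absurd (h1 c hc hcW) hc1
  · exact ⟨lam, hlam, (hgen lam (one_pos.trans hlam)).2 ⟨1, (zpow_one lam).symm⟩, hgen⟩

/-- **On the stratum, the least factor of a SINGULAR past-DSS member is at least the uniform
threshold `λ₀(C,K)`, generates all its factors, and every factor `c > 1` is a positive power of
it.** -/
theorem least_factor_ge_threshold_of_singular (C K : ℝ) : ∃ lam₀ : ℝ, 1 < lam₀ ∧
    ∀ (W : ℝ → EuclideanSpace ℝ (Fin 3) → EuclideanSpace ℝ (Fin 3)),
      IsTypeIAncientMild C W →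
      (∀ s : ℝ, s < 0 → ∫⁻ x, ‖fderiv ℝ (W s) x‖ₑ ^ 2 ≤ ENNReal.ofReal (K / Real.sqrt (-s))) →
      (∀ r > 0, ∀ M : ℝ, ∃ t ∈ Set.Ioo (-(r ^ 2)) (0 : ℝ),
          ∃ x ∈ Metric.ball (0 : EuclideanSpace ℝ (Fin 3)) r, M < ‖W t x‖) →
      ∀ c : ℝ, 1 < c → (∀ t : ℝ, t < 0 → ∀ x, c • W (c ^ 2 * t) (c • x) = W t x) →
        ∃ lam : ℝ, lam₀ ≤ lam ∧
          (∀ t : ℝ, t < 0 → ∀ x, lam • W (lam ^ 2 * t) (lam • x) = W t x) ∧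
          (∀ c' : ℝ, 0 < c' →
            ((∀ t : ℝ, t < 0 → ∀ x, c' • W (c' ^ 2 * t) (c' • x) = W t x) ↔
              ∃ k : ℤ, c' = lam ^ k)) ∧
          ∃ k : ℕ, 1 ≤ k ∧ c = lam ^ k := by
  obtain ⟨lam₀, hlam₀, hthr⟩ := pastDss_factor_ge_of_singular C K
  refine ⟨lam₀, hlam₀, fun W hW hlaw hsing c hc hcW => ?_⟩
  obtain ⟨lam, hlam, hlamW, hgen⟩ :=
    exists_least_factor_of_pastDss hW (not_forall_eq_zero_of_singular hsing) (one_pos.trans hc) hc.ne' hcW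
  refine ⟨lam, hthr W hW hlaw hsing lam hlam hlamW, hlamW, hgen, ?_⟩
  obtain ⟨k, hk⟩ := (hgen c (one_pos.trans hc)).1 hcW
  -- `c = lam^k > 1` with `lam > 1` forces `k ≥ 1`
  have hk1 : 1 ≤ k := by
    by_contra hk0
    push Not at hk0
    have : c ≤ 1 := by
      rw [hk]
      exact zpow_le_one_of_nonpos₀ hlam.le (by omega)
    linarith
  refine ⟨k.toNat, by omega, ?_⟩
  rw [hk, ← zpow_natCast]
  congr 1
  omega

end Summit.NavierStokesRegularity.NavierStokesRegularity.Theorems.FiniteDissipationLiouville.Birth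

end
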